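import Literature.MathematicalPhysics.QuantumFieldTheory.ConformalBootstrap3D.PointFunctionalTermwise
import Literature.MathematicalPhysics.QuantumFieldTheory.ConformalBootstrap3D.BlockZSeriesAB

/-!
# Obligations of a mixed-correlator (`σ–ε`) point certificate, and the even-sector termwise rule

The single-correlator chain (`SingleCorrelatorObligations` … `boxExcluded_of_pointTable₂`) can only
produce one-sided bounds (the generalised-free line `Δ_ε = 2Δ_σ` satisfies rule 1 with the gap):
an ISLAND needs the three-correlator system, i.e. a 5-vector `α⃗ = (α¹,…,α⁵)` of functionals and
the positivity conditions `CrossingFunctional.IsPositiveAt` of Kos–Poland–Simmons-Duffin 2014,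
eq. (3.16) (typed in `DualFunctional`; `boxExcluded_of_pointFunctional` PROVES that positivity on a
box `Q` excludes `Q`). This file starts the mixed analogue of the B″ chain:

* `EvenPositive` / `OddPositive`: the `ℤ₂`-even quadratic-form condition and the `ℤ₂`-odd
  condition at one `(Δ, ℓ)`, over ALL genuine blocks (as `BlockPositive`);
* `MixedObligations α Q E₀`: the obligation list — identity; even sector: `ε` itself, scalars
  `[3, E₀)`, even spins `ℓ ≥ 2` on `[ℓ+1, E₀)`, tail `Δ ≥ E₀`; odd sector: `σ` itself, scalars
  `[3, E₀)`, ALL spins `ℓ ≥ 1` on `[ℓ+1, E₀)`, tail — and `MixedObligations.isPositiveAt`,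
  `MixedObligations.boxExcluded` (for point 5-vectors `ofPoints z z̄ w`);
* the EVEN-SECTOR TERMWISE RULE at regular points: with the `z`-series of `g^{0,0}_{Δ,ℓ}`
  (coefficients `A_{n,j} ≥ 0`) the quadratic form is `Σ_{(n,j)} (A_{n,j}/λ_ℓ) q_{E,j}(a,b)` with the
  TERM FORM `q_{E,j}(a,b) = a² Φ¹(E,j,Δ_σ) + b² Φ²(E,j,Δ_ε) + ab (Φ⁴₋(E,j,s) + Φ⁵₊(E,j,s))`
  (`evenTermForm`, `hasSum_evenForm_ofPoints`), so a non-negative head form plus termwise PSD tail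
  terms give `EvenPositive` (`evenPositive_ofPoints_of_termwise`); termwise PSD from three numbers
  (`evenTermForm_nonneg_of_det`); non-regular points by right limits
  (`evenPositive_ofPoints_of_eventually_right`, `oddPositive_ofPoints_of_eventually_right`).

The odd sector's termwise rule needs the `z`-series of BOTH families `g^{±Δ_σε,Δ_σε}`
(`hasSum_oddForm_ofPoints`, `oddTermForm`: the spin-parity sign `(-1)^ℓ` multiplies the signed
`⟨σεσε⟩` family, ERRATUM 2026-08-19 of `SigmaEpsilonData.SatisfiesCrossing`; the parity-uniform
sufficient condition `oddTermForm_nonneg_of_abs_le` asks the reflection-positive `⟨εσσε⟩` entries to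
dominate) — in the obligation list `OddPositive` stays a hypothesis.
[cite: KosPolandSimmonsduffin2014, §3.3 eq. (3.16)]
-/

noncomputable section

namespace Literature.MathematicalPhysics.QuantumFieldTheory.ConformalBootstrap3D

open Finset Set Filter Topology

namespace CrossingFunctional

/-- **Even-sector positivity at `(Δ, ℓ)`** for external dimensions `(Δ_σ, Δ_ε)`: the quadratic form
`(a b) α⃗·V⃗_{+,Δ,ℓ} (a b)ᵀ ≥ 0` for all `(a, b)` and EVERY genuine block `g^{0,0}_{Δ,ℓ}`
(Kos–Poland–Simmons-Duffin 2014, eq. (3.16), second line). [cite: KosPolandSimmonsduffin2014, §3.3 eq. (3.16)] -/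
def EvenPositive (α : CrossingFunctional) (Δσ Δε Δ : ℝ) (ℓ : ℕ) : Prop :=
  ∀ g : ℝ → ℝ → ℝ, IsConformalBlock3D 0 0 Δ ℓ g → ∀ a b : ℝ, 0 ≤ α.evenForm Δσ Δε g a b

/-- **Odd-sector positivity at `(Δ, ℓ)`**: `α⃗·V⃗_{-,Δ,ℓ} ≥ 0` for EVERY pair of genuine blocks
`g^{Δ_σε,Δ_σε}_{Δ,ℓ}`, `g^{-Δ_σε,Δ_σε}_{Δ,ℓ}` (Kos–Poland–Simmons-Duffin 2014, eq. (3.16), third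
line). [cite: KosPolandSimmonsduffin2014, §3.3 eq. (3.16)] -/
def OddPositive (α : CrossingFunctional) (Δσ Δε Δ : ℝ) (ℓ : ℕ) : Prop :=
  ∀ g₁ g₂ : ℝ → ℝ → ℝ, IsConformalBlock3D (Δσ - Δε) (Δσ - Δε) Δ ℓ g₁ →
    IsConformalBlock3D (-(Δσ - Δε)) (Δσ - Δε) Δ ℓ g₂ → 0 ≤ α.oddForm Δσ Δε ℓ g₁ g₂

end CrossingFunctional

/-- **The obligations of a mixed-correlator certificate** for a 5-vector `α⃗`, a box `Q` of
`(Δ_σ, Δ_ε)` and a head threshold `E₀`, copied from `IsPositiveAt` with the spectrum split into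
light and heavy parts: (I) identity; even sector (even spins, scalars below `3` only at `Δ_ε`):
(E2) `ε` itself, (E3) scalars `3 ≤ Δ < E₀`, (E4) even `ℓ ≠ 0`, `ℓ + 1 ≤ Δ < E₀`, (E5) tail;
odd sector (all spins, scalars below `3` only at `Δ_σ`): (D2) `σ` itself, (D3) scalars
`3 ≤ Δ < E₀`, (D4) every `ℓ ≠ 0`, `ℓ + 1 ≤ Δ < E₀`, (D5) tail. (E2)/(D2) are required on all of
`Q` even where redundant; harmless. [cite: KosPolandSimmonsduffin2014, §3.3 eq. (3.16)] -/
structure MixedObligations (α : CrossingFunctional) (Q : Set (ℝ × ℝ)) (E₀ : ℝ) : Prop where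
  /-- (I) the identity term is positive on `Q`. -/
  identity_pos : ∀ p ∈ Q, 0 < α.identityTerm p.1 p.2
  /-- (E2) the exchanged `ε` in the even sector: `ℓ = 0`, `Δ = Δ_ε`. -/
  epsilon_even : ∀ p ∈ Q, α.EvenPositive p.1 p.2 p.2 0
  /-- (E3) even-sector scalars above the gap and below `E₀`. -/
  scalar_even : ∀ p ∈ Q, ∀ Δ : ℝ, 3 ≤ Δ → Δ < E₀ → α.EvenPositive p.1 p.2 Δ 0
  /-- (E4) even non-zero spins between the unitarity bound and `E₀`. -/
  spinning_even : ∀ p ∈ Q, ∀ ℓ : ℕ, Even ℓ → ℓ ≠ 0 → ∀ Δ : ℝ, (ℓ : ℝ) + 1 ≤ Δ → Δ < E₀ →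
    α.EvenPositive p.1 p.2 Δ ℓ
  /-- (E5) even-sector tail: every even spin, `Δ ≥ E₀` above the unitarity bound. -/
  tail_even : ∀ p ∈ Q, ∀ ℓ : ℕ, Even ℓ → ∀ Δ : ℝ, unitarityBound3D ℓ ≤ Δ → E₀ ≤ Δ →
    α.EvenPositive p.1 p.2 Δ ℓ
  /-- (D2) the exchanged `σ` in the odd sector: `ℓ = 0`, `Δ = Δ_σ`. -/
  sigma_odd : ∀ p ∈ Q, α.OddPositive p.1 p.2 p.1 0
  /-- (D3) odd-sector scalars above the gap and below `E₀`. -/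
  scalar_odd : ∀ p ∈ Q, ∀ Δ : ℝ, 3 ≤ Δ → Δ < E₀ → α.OddPositive p.1 p.2 Δ 0
  /-- (D4) odd sector, every non-zero spin (both parities) between the bound and `E₀`. -/
  spinning_odd : ∀ p ∈ Q, ∀ ℓ : ℕ, ℓ ≠ 0 → ∀ Δ : ℝ, (ℓ : ℝ) + 1 ≤ Δ → Δ < E₀ →
    α.OddPositive p.1 p.2 Δ ℓ
  /-- (D5) odd-sector tail: every spin, `Δ ≥ E₀` above the unitarity bound. -/
  tail_odd : ∀ p ∈ Q, ∀ ℓ : ℕ, ∀ Δ : ℝ, unitarityBound3D ℓ ≤ Δ → E₀ ≤ Δ →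
    α.OddPositive p.1 p.2 Δ ℓ

namespace MixedObligations

variable {α : CrossingFunctional} {Q : Set (ℝ × ℝ)} {E₀ : ℝ}

/-- The obligation list is exactly `IsPositiveAt` at every point of `Q` (case split on `Δ < E₀`,
`ℓ = 0`, `Δ < 3`; for `ℓ ≠ 0` the unitarity bound reads `ℓ + 1 ≤ Δ`). Elementary.
[cite: KosPolandSimmonsduffin2014, §3.3 eq. (3.16)] -/
theorem isPositiveAt (h : MixedObligations α Q E₀) : ∀ p ∈ Q, α.IsPositiveAt p.1 p.2 := by
  intro p hp
  refine ⟨h.identity_pos p hp, ?_, ?_⟩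
  · intro Δ ℓ g hℓ hb hgap hg a b
    rcases lt_or_ge Δ E₀ with hlt | hge
    · by_cases h0 : ℓ = 0
      · subst h0
        rcases lt_or_ge Δ 3 with h3 | h3
        · have hΔ : Δ = p.2 := hgap rfl h3
          subst hΔ
          exact h.epsilon_even p hp g hg a b
        · exact h.scalar_even p hp Δ h3 hlt g hg a b
      · have hb' : (ℓ : ℝ) + 1 ≤ Δ := by simpa [unitarityBound3D, h0] using hb
        exact h.spinning_even p hp ℓ hℓ h0 Δ hb' hlt g hg a b
    · exact h.tail_even p hp ℓ hℓ Δ hb hge g hg a b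
  · intro Δ ℓ g₁ g₂ hb hgap hg₁ hg₂
    rcases lt_or_ge Δ E₀ with hlt | hge
    · by_cases h0 : ℓ = 0
      · subst h0
        rcases lt_or_ge Δ 3 with h3 | h3
        · have hΔ : Δ = p.1 := hgap rfl h3
          subst hΔ
          exact h.sigma_odd p hp g₁ g₂ hg₁ hg₂
        · exact h.scalar_odd p hp Δ h3 hlt g₁ g₂ hg₁ hg₂
      · have hb' : (ℓ : ℝ) + 1 ≤ Δ := by simpa [unitarityBound3D, h0] using hb
        exact h.spinning_odd p hp ℓ h0 Δ hb' hlt g₁ g₂ hg₁ hg₂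
    · exact h.tail_odd p hp ℓ Δ hb hge g₁ g₂ hg₁ hg₂

/-- **A discharged mixed obligation list is a certificate.** For a 5-vector of point-evaluation
functionals on common nodes in the open square, the obligations on `Q` give `BoxExcluded Q`
(termwise action on the five sum rules is proved, `boxExcluded_of_pointFunctional`).
[cite: KosPolandSimmonsduffin2014, §3.3 eq. (3.16)] -/
theorem boxExcluded {n : ℕ} {z zb : Fin n → ℝ} {w : Fin 5 → Fin n → ℝ}
    (hz : ∀ k, z k ∈ Ioo (0 : ℝ) 1) (hzb : ∀ k, zb k ∈ Ioo (0 : ℝ) 1)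
    (h : MixedObligations (CrossingFunctional.ofPoints z zb w) Q E₀) : BoxExcluded Q :=
  CrossingFunctional.boxExcluded_of_pointFunctional z zb w hz hzb Q h.isPositiveAt

end MixedObligations

/-! ### The even sector, termwise -/

/-- **The even-sector term form** of a point 5-vector at the `z`-series term `𝒫_{E,j}`:
`q_{E,j}(a,b) = a² Φ¹(E,j,Δ_σ) + b² Φ²(E,j,Δ_ε) + ab (Φ⁴₋(E,j,s) + Φ⁵₊(E,j,s))`, `s = (Δ_σ+Δ_ε)/2`,
where `Φⁱ_∓(E,j,t) = αⁱ[F^{t}_{∓}[𝒫_{E,j}]]` (weights `w 0, w 1, w 3, w 4` of `α¹, α², α⁴, α⁵`).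
[cite: KosPolandSimmonsduffin2014, §3.2 eq. (3.14)] -/
def evenTermForm {n : ℕ} (z zb : Fin n → ℝ) (w : Fin 5 → Fin n → ℝ) (Δσ Δε E : ℝ) (j : ℕ)
    (a b : ℝ) : ℝ :=
  a ^ 2 * pointFunctional (w 0) z zb (crossF Δσ (-1) (zMono E j)) +
    b ^ 2 * pointFunctional (w 1) z zb (crossF Δε (-1) (zMono E j)) +
    a * b * (pointFunctional (w 3) z zb (crossF ((Δσ + Δε) / 2) (-1) (zMono E j)) +
      pointFunctional (w 4) z zb (crossF ((Δσ + Δε) / 2) 1 (zMono E j)))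

/-- **Termwise PSD from three numbers**: `Φ¹ ≥ 0`, `Φ² ≥ 0`, `(Φ⁴₋ + Φ⁵₊)² ≤ 4 Φ¹ Φ²` at `(E, j)` give
`q_{E,j}(a,b) ≥ 0` for all `(a, b)`. [folklore] -/
theorem evenTermForm_nonneg_of_det {n : ℕ} (z zb : Fin n → ℝ) (w : Fin 5 → Fin n → ℝ)
    {Δσ Δε E : ℝ} {j : ℕ}
    (hX : 0 ≤ pointFunctional (w 0) z zb (crossF Δσ (-1) (zMono E j)))
    (hY : 0 ≤ pointFunctional (w 1) z zb (crossF Δε (-1) (zMono E j)))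
    (hZ : (pointFunctional (w 3) z zb (crossF ((Δσ + Δε) / 2) (-1) (zMono E j)) +
        pointFunctional (w 4) z zb (crossF ((Δσ + Δε) / 2) 1 (zMono E j))) ^ 2 ≤
      4 * pointFunctional (w 0) z zb (crossF Δσ (-1) (zMono E j)) *
        pointFunctional (w 1) z zb (crossF Δε (-1) (zMono E j))) :
    ∀ a b : ℝ, 0 ≤ evenTermForm z zb w Δσ Δε E j a b :=
  fun a b => quadForm_nonneg_of_det hX hY hZ a b

/-- **The even-sector quadratic form is the `z`-series sum of the term forms** (regular `(Δ, ℓ)`,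
genuine `g^{0,0}_{Δ,ℓ}`): `evenForm(g; a, b) = Σ_{(n,j)} (A_{n,j}/λ_ℓ) q_{Δ+n,j}(a,b)` — four
applications of the termwise action of a point functional. [cite: HogervorstRychkov2013, §3 eq. (3.9)] -/
theorem hasSum_evenForm_ofPoints {n : ℕ} (z zb : Fin n → ℝ) (w : Fin 5 → Fin n → ℝ)
    (hz : ∀ k, z k ∈ Ioo (0 : ℝ) 1) (hzb : ∀ k, zb k ∈ Ioo (0 : ℝ) 1) {Δ : ℝ} {ℓ : ℕ}
    {g : ℝ → ℝ → ℝ} (hΔ : unitarityBound3D ℓ < Δ) (hreg : ¬ accidentalDegeneracy3D Δ ℓ)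
    (hg : IsConformalBlock3D 0 0 Δ ℓ g) (Δσ Δε a b : ℝ) :
    HasSum (fun q : ℕ × ℕ => hrCoeff Δ ℓ q.1 q.2 / legendreLam ℓ *
        evenTermForm z zb w Δσ Δε (Δ + (q.1 : ℝ)) q.2 a b)
      ((CrossingFunctional.ofPoints z zb w).evenForm Δσ Δε g a b) := by
  have h1 := hasSum_pointFunctional_crossF_hrZ (w 0) z zb hz hzb Δσ (-1) hΔ hreg hg
  have h2 := hasSum_pointFunctional_crossF_hrZ (w 1) z zb hz hzb Δε (-1) hΔ hreg hg
  have h4 := hasSum_pointFunctional_crossF_hrZ (w 3) z zb hz hzb ((Δσ + Δε) / 2) (-1) hΔ hreg hg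
  have h5 := hasSum_pointFunctional_crossF_hrZ (w 4) z zb hz hzb ((Δσ + Δε) / 2) 1 hΔ hreg hg
  have hs := ((h1.mul_left (a ^ 2)).add (h2.mul_left (b ^ 2))).add ((h4.add h5).mul_left (a * b))
  have hL : (CrossingFunctional.ofPoints z zb w).evenForm Δσ Δε g a b =
      a ^ 2 * pointFunctional (w 0) z zb (crossF Δσ (-1) g) +
        b ^ 2 * pointFunctional (w 1) z zb (crossF Δε (-1) g) +
        a * b * (pointFunctional (w 3) z zb (crossF ((Δσ + Δε) / 2) (-1) g) +
          pointFunctional (w 4) z zb (crossF ((Δσ + Δε) / 2) 1 g)) := rfl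
  rw [hL]
  exact hs.congr_fun fun q => by simp only [evenTermForm]; ring

/-- **Even-sector positivity from termwise PSD (finite head + PSD tail terms), regular point.** If
the head form `Σ_{(n,j) ∈ F} (A_{n,j}/λ_ℓ) q_{Δ+n,j}(a,b)` is `≥ 0` for all `(a,b)` and every term
form outside `F` on the descendant range is PSD, then `EvenPositive` at `(Δ, ℓ)`.
[cite: HogervorstRychkov2013, §3 eq. (3.9)] -/
theorem evenPositive_ofPoints_of_termwise {n : ℕ} (z zb : Fin n → ℝ) (w : Fin 5 → Fin n → ℝ)
    (hz : ∀ k, z k ∈ Ioo (0 : ℝ) 1) (hzb : ∀ k, zb k ∈ Ioo (0 : ℝ) 1) {Δσ Δε Δ : ℝ} {ℓ : ℕ}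
    (hΔ : unitarityBound3D ℓ < Δ) (hreg : ¬ accidentalDegeneracy3D Δ ℓ) (F : Finset (ℕ × ℕ))
    (hhead : ∀ a b : ℝ, 0 ≤ ∑ q ∈ F, hrCoeff Δ ℓ q.1 q.2 / legendreLam ℓ *
      evenTermForm z zb w Δσ Δε (Δ + (q.1 : ℝ)) q.2 a b)
    (htail : ∀ q : ℕ × ℕ, q ∉ F → InDescendantRange ℓ q.1 q.2 →
      ∀ a b : ℝ, 0 ≤ evenTermForm z zb w Δσ Δε (Δ + (q.1 : ℝ)) q.2 a b) :
    (CrossingFunctional.ofPoints z zb w).EvenPositive Δσ Δε Δ ℓ := by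
  intro g hg a b
  have hS := hasSum_evenForm_ofPoints z zb w hz hzb hΔ hreg hg Δσ Δε a b
  refine (hhead a b).trans (sum_le_hasSum F (fun q hq => ?_) hS)
  by_cases hr : InDescendantRange ℓ q.1 q.2
  · exact mul_nonneg (div_nonneg (hrCoeff_nonneg hΔ _ _) (legendreLam_pos ℓ).le)
      (htail q hq hr a b)
  · rw [hrCoeff_eq_zero_of_not_inDescendantRange Δ hr, zero_div, zero_mul]

/-- **Fully termwise form** (`F = ∅`). [cite: HogervorstRychkov2013, §3 eq. (3.9)] -/
theorem evenPositive_ofPoints_of_forall {n : ℕ} (z zb : Fin n → ℝ) (w : Fin 5 → Fin n → ℝ)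
    (hz : ∀ k, z k ∈ Ioo (0 : ℝ) 1) (hzb : ∀ k, zb k ∈ Ioo (0 : ℝ) 1) {Δσ Δε Δ : ℝ} {ℓ : ℕ}
    (hΔ : unitarityBound3D ℓ < Δ) (hreg : ¬ accidentalDegeneracy3D Δ ℓ)
    (hterm : ∀ q : ℕ × ℕ, InDescendantRange ℓ q.1 q.2 →
      ∀ a b : ℝ, 0 ≤ evenTermForm z zb w Δσ Δε (Δ + (q.1 : ℝ)) q.2 a b) :
    (CrossingFunctional.ofPoints z zb w).EvenPositive Δσ Δε Δ ℓ :=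
  evenPositive_ofPoints_of_termwise z zb w hz hzb hΔ hreg ∅ (by simp) (fun q _ hr => hterm q hr)

/-! ### The odd sector, termwise by levels (exact identity; signed coefficients) -/

/-- A point functional applied to `F^{s}_{sign}` of a finite combination `Σ_i c_i f_i` is the same
combination of its values. [folklore] -/
theorem pointFunctional_crossF_sum_mul {n : ℕ} (w z zb : Fin n → ℝ) (s sign : ℝ) {ι : Type*}
    (S : Finset ι) (c : ι → ℝ) (f : ι → ℝ → ℝ → ℝ) :
    pointFunctional w z zb (crossF s sign (fun x y => ∑ i ∈ S, c i * f i x y)) =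
      ∑ i ∈ S, c i * pointFunctional w z zb (crossF s sign (f i)) := by
  simp only [pointFunctional_apply, crossF]
  calc ∑ k, w k * (((1 - z k) * (1 - zb k)) ^ s * ∑ i ∈ S, c i * f i (z k) (zb k) +
          sign * (z k * zb k) ^ s * ∑ i ∈ S, c i * f i (1 - z k) (1 - zb k))
      = ∑ k, ∑ i ∈ S, w k * (((1 - z k) * (1 - zb k)) ^ s * (c i * f i (z k) (zb k)) +
          sign * (z k * zb k) ^ s * (c i * f i (1 - z k) (1 - zb k))) := by
        refine Finset.sum_congr rfl fun k _ => ?_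
        rw [Finset.mul_sum, Finset.mul_sum, ← Finset.sum_add_distrib, Finset.mul_sum]
    _ = ∑ i ∈ S, ∑ k, w k * (((1 - z k) * (1 - zb k)) ^ s * (c i * f i (z k) (zb k)) +
          sign * (z k * zb k) ^ s * (c i * f i (1 - z k) (1 - zb k))) := Finset.sum_comm
    _ = ∑ i ∈ S, c i * ∑ k, w k * (((1 - z k) * (1 - zb k)) ^ s * f i (z k) (zb k) +
          sign * (z k * zb k) ^ s * f i (1 - z k) (1 - zb k)) := by
        refine Finset.sum_congr rfl fun i _ => ?_
        rw [Finset.mul_sum]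
        refine Finset.sum_congr rfl fun k _ => ?_
        ring

/-- **Termwise action of a point functional on a general mixed block, by levels.** For a genuine
`g^{Δ₁₂,Δ₃₄}_{Δ,ℓ}` at a regular `(Δ, ℓ)` (any `Δ₁₂, Δ₃₄`; coefficients `A_{n,j}(a,b)`, `a = -Δ₁₂/2`,
`b = Δ₃₄/2`, possibly SIGNED): `φ[F^{s}_{sign}[g]] = Σ_n Σ_{j ≤ ℓ+n} (A_{n,j}(a,b)/λ_ℓ) φ[F^{s}_{sign}[𝒫_{Δ+n,j}]]`
as a convergent series over the levels `n` (`IsConformalBlock3D.hasSum_hrLevelAB`).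
[cite: DolanOsborn2004, §3 eqs. (3.10)–(3.12)] -/
theorem hasSum_pointFunctional_crossF_hrLevelAB {n : ℕ} (w z zb : Fin n → ℝ)
    (hz : ∀ k, z k ∈ Ioo (0 : ℝ) 1) (hzb : ∀ k, zb k ∈ Ioo (0 : ℝ) 1) (s sign : ℝ)
    {Δ₁₂ Δ₃₄ Δ : ℝ} {ℓ : ℕ} {g : ℝ → ℝ → ℝ} (hΔ : unitarityBound3D ℓ < Δ)
    (hreg : ¬ accidentalDegeneracy3D Δ ℓ) (h : IsConformalBlock3D Δ₁₂ Δ₃₄ Δ ℓ g) :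
    HasSum (fun m : ℕ => ∑ j ∈ range (ℓ + m + 1),
        hrCoeffAB (-Δ₁₂ / 2) (Δ₃₄ / 2) Δ ℓ m j / legendreLam ℓ *
          pointFunctional w z zb (crossF s sign (zMono (Δ + (m : ℝ)) j)))
      (pointFunctional w z zb (crossF s sign g)) := by
  have hpt : ∀ x y : ℝ, x ∈ Ioo (0 : ℝ) 1 → y ∈ Ioo (0 : ℝ) 1 →
      HasSum (fun m : ℕ => (fun x' y' => hrLevelAB (-Δ₁₂ / 2) (Δ₃₄ / 2) Δ ℓ x' y' m) x y) (g x y) :=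
    fun x y hx hy => h.hasSum_hrLevelAB hΔ hreg hx hy
  have hF := evaluationContinuous_pointFunctional w z zb hz hzb ℕ _ _
    (fun x y hx hy => hasSum_crossF s sign hpt hx hy)
  have hfun : (fun m : ℕ => pointFunctional w z zb (crossF s sign
      (fun x' y' => hrLevelAB (-Δ₁₂ / 2) (Δ₃₄ / 2) Δ ℓ x' y' m))) =
      fun m : ℕ => ∑ j ∈ range (ℓ + m + 1),
        hrCoeffAB (-Δ₁₂ / 2) (Δ₃₄ / 2) Δ ℓ m j / legendreLam ℓ *
          pointFunctional w z zb (crossF s sign (zMono (Δ + (m : ℝ)) j)) := by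
    funext m
    have hlev : (fun x' y' => hrLevelAB (-Δ₁₂ / 2) (Δ₃₄ / 2) Δ ℓ x' y' m) =
        fun x' y' => ∑ j ∈ range (ℓ + m + 1),
          (hrCoeffAB (-Δ₁₂ / 2) (Δ₃₄ / 2) Δ ℓ m j / legendreLam ℓ) * zMono (Δ + (m : ℝ)) j x' y' := by
      funext x' y'
      simp only [hrLevelAB, hrZTermAB]
    rw [hlev, pointFunctional_crossF_sum_mul]
  rw [hfun] at hF
  exact hF

/-- **The odd-sector term** of a point 5-vector at level `n`, spin index `j`:
`t_{n,j} = (-1)^ℓ (A_{n,j}(-c,c)/λ_ℓ) Φ³₋(Δ+n, j, s) + (A_{n,j}(c,c)/λ_ℓ) (Φ⁴₋(Δ+n, j, Δ_σ) - Φ⁵₊(Δ+n, j, Δ_σ))`,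
`c = Δ_σε/2 = (Δ_σ - Δ_ε)/2`, `s = (Δ_σ+Δ_ε)/2`: the `σεσε` block `g^{Δ_σε,Δ_σε}` has the SIGNED
coefficients `A(-c,c)` and carries the spin-parity sign `(-1)^ℓ` (`CrossingFunctional.oddForm`,
ERRATUM 2026-08-19 of `SigmaEpsilonData.SatisfiesCrossing`), the reflection-positive `εσσε` block
`g^{-Δ_σε,Δ_σε}` the non-negative `A(c,c)` with coefficient `+1` for both parities.
[cite: KosPolandSimmonsduffin2014, §3.2 eq. (3.13)] -/
def oddTermForm {n : ℕ} (z zb : Fin n → ℝ) (w : Fin 5 → Fin n → ℝ) (Δσ Δε Δ : ℝ) (ℓ m j : ℕ) :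
    ℝ :=
  (-1 : ℝ) ^ ℓ * (hrCoeffAB (-(Δσ - Δε) / 2) ((Δσ - Δε) / 2) Δ ℓ m j / legendreLam ℓ) *
      pointFunctional (w 2) z zb (crossF ((Δσ + Δε) / 2) (-1) (zMono (Δ + (m : ℝ)) j)) +
    hrCoeffAB ((Δσ - Δε) / 2) ((Δσ - Δε) / 2) Δ ℓ m j / legendreLam ℓ *
      (pointFunctional (w 3) z zb (crossF Δσ (-1) (zMono (Δ + (m : ℝ)) j)) -
        pointFunctional (w 4) z zb (crossF Δσ 1 (zMono (Δ + (m : ℝ)) j)))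

/-- Off the descendant range the odd-sector term vanishes (both coefficient families do).
[cite: DolanOsborn2004, §3 eq. (3.10)] -/
theorem oddTermForm_eq_zero_of_not_inDescendantRange {n : ℕ} (z zb : Fin n → ℝ)
    (w : Fin 5 → Fin n → ℝ) (Δσ Δε Δ : ℝ) {ℓ m j : ℕ} (h : ¬ InDescendantRange ℓ m j) :
    oddTermForm z zb w Δσ Δε Δ ℓ m j = 0 := by
  simp [oddTermForm, hrCoeffAB_eq_zero_of_not_inDescendantRange _ _ Δ h]

/-- **The odd-sector form is the level series of the odd terms** (regular `(Δ, ℓ)`, genuine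
`g₁ = g^{Δ_σε,Δ_σε}_{Δ,ℓ}`, `g₂ = g^{-Δ_σε,Δ_σε}_{Δ,ℓ}`): `oddForm(g₁, g₂) = Σ_n Σ_{j ≤ ℓ+n} t_{n,j}`.
[cite: KosPolandSimmonsduffin2014, §3.2 eq. (3.13)] -/
theorem hasSum_oddForm_ofPoints {n : ℕ} (z zb : Fin n → ℝ) (w : Fin 5 → Fin n → ℝ)
    (hz : ∀ k, z k ∈ Ioo (0 : ℝ) 1) (hzb : ∀ k, zb k ∈ Ioo (0 : ℝ) 1) {Δσ Δε Δ : ℝ} {ℓ : ℕ}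
    {g₁ g₂ : ℝ → ℝ → ℝ} (hΔ : unitarityBound3D ℓ < Δ) (hreg : ¬ accidentalDegeneracy3D Δ ℓ)
    (hg₁ : IsConformalBlock3D (Δσ - Δε) (Δσ - Δε) Δ ℓ g₁)
    (hg₂ : IsConformalBlock3D (-(Δσ - Δε)) (Δσ - Δε) Δ ℓ g₂) :
    HasSum (fun m : ℕ => ∑ j ∈ range (ℓ + m + 1), oddTermForm z zb w Δσ Δε Δ ℓ m j)
      ((CrossingFunctional.ofPoints z zb w).oddForm Δσ Δε ℓ g₁ g₂) := by
  have h3 := hasSum_pointFunctional_crossF_hrLevelAB (w 2) z zb hz hzb ((Δσ + Δε) / 2) (-1)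
    hΔ hreg hg₁
  have h4 := hasSum_pointFunctional_crossF_hrLevelAB (w 3) z zb hz hzb Δσ (-1) hΔ hreg hg₂
  have h5 := hasSum_pointFunctional_crossF_hrLevelAB (w 4) z zb hz hzb Δσ 1 hΔ hreg hg₂
  simp only [neg_neg] at h4 h5
  have hs := (h3.mul_left ((-1 : ℝ) ^ ℓ)).add (h4.sub h5)
  have hL : (CrossingFunctional.ofPoints z zb w).oddForm Δσ Δε ℓ g₁ g₂ =
      (-1 : ℝ) ^ ℓ * pointFunctional (w 2) z zb (crossF ((Δσ + Δε) / 2) (-1) g₁) +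
        (pointFunctional (w 3) z zb (crossF Δσ (-1) g₂) -
          pointFunctional (w 4) z zb (crossF Δσ 1 g₂)) := by
    simp only [CrossingFunctional.oddForm, CrossingFunctional.ofPoints]
    ring
  rw [hL]
  refine hs.congr_fun fun m => ?_
  rw [Finset.mul_sum, ← Finset.sum_sub_distrib, ← Finset.sum_add_distrib]
  refine Finset.sum_congr rfl fun j _ => ?_
  simp only [oddTermForm]
  ring

/-- **Odd-sector positivity from termwise positivity by levels (finite head of levels + termwise
tail), regular point.** [cite: KosPolandSimmonsduffin2014, §3.2 eq. (3.13)] -/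
theorem oddPositive_ofPoints_of_termwise {n : ℕ} (z zb : Fin n → ℝ) (w : Fin 5 → Fin n → ℝ)
    (hz : ∀ k, z k ∈ Ioo (0 : ℝ) 1) (hzb : ∀ k, zb k ∈ Ioo (0 : ℝ) 1) {Δσ Δε Δ : ℝ} {ℓ : ℕ}
    (hΔ : unitarityBound3D ℓ < Δ) (hreg : ¬ accidentalDegeneracy3D Δ ℓ) (N₀ : ℕ)
    (hhead : 0 ≤ ∑ m ∈ range N₀, ∑ j ∈ range (ℓ + m + 1), oddTermForm z zb w Δσ Δε Δ ℓ m j)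
    (htail : ∀ m j : ℕ, N₀ ≤ m → InDescendantRange ℓ m j →
      0 ≤ oddTermForm z zb w Δσ Δε Δ ℓ m j) :
    (CrossingFunctional.ofPoints z zb w).OddPositive Δσ Δε Δ ℓ := by
  intro g₁ g₂ hg₁ hg₂
  have hS := hasSum_oddForm_ofPoints z zb w hz hzb hΔ hreg hg₁ hg₂
  refine hhead.trans (sum_le_hasSum (range N₀) (fun m hm => ?_) hS)
  have hm' : N₀ ≤ m := by simpa using hm
  refine sum_nonneg fun j _ => ?_
  by_cases hr : InDescendantRange ℓ m j
  · exact htail m j hm' hr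
  · rw [oddTermForm_eq_zero_of_not_inDescendantRange z zb w Δσ Δε Δ hr]

/-- **Closed-form sufficient condition for one odd term (both parities)**: `|A_{n,j}(-c,c)| · |Φ³| ≤
A_{n,j}(c,c) (Φ⁴₋ - Φ⁵₊)` gives `t_{n,j} ≥ 0` (`(-1)^ℓ A(-c,c) Φ³ ≥ -|A(-c,c)| |Φ³|`, `λ_ℓ > 0`):
the reflection-positive `⟨εσσε⟩` entries (`A(c,c) ≥ 0` on the descendant range,
`hrCoeffAB_sigmaEps_nonneg`-type facts) dominate the signed `⟨σεσε⟩` entry, uniformly in the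
parity of `ℓ` — the shape of a termwise odd-sector tail rule. [folklore] -/
theorem oddTermForm_nonneg_of_abs_le {n : ℕ} (z zb : Fin n → ℝ) (w : Fin 5 → Fin n → ℝ)
    {Δσ Δε Δ : ℝ} {ℓ m j : ℕ}
    (h : |hrCoeffAB (-(Δσ - Δε) / 2) ((Δσ - Δε) / 2) Δ ℓ m j| *
        |pointFunctional (w 2) z zb (crossF ((Δσ + Δε) / 2) (-1) (zMono (Δ + (m : ℝ)) j))| ≤
      hrCoeffAB ((Δσ - Δε) / 2) ((Δσ - Δε) / 2) Δ ℓ m j *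
        (pointFunctional (w 3) z zb (crossF Δσ (-1) (zMono (Δ + (m : ℝ)) j)) -
          pointFunctional (w 4) z zb (crossF Δσ 1 (zMono (Δ + (m : ℝ)) j)))) :
    0 ≤ oddTermForm z zb w Δσ Δε Δ ℓ m j := by
  set A := hrCoeffAB (-(Δσ - Δε) / 2) ((Δσ - Δε) / 2) Δ ℓ m j
  set B := hrCoeffAB ((Δσ - Δε) / 2) ((Δσ - Δε) / 2) Δ ℓ m j
  set P := pointFunctional (w 2) z zb (crossF ((Δσ + Δε) / 2) (-1) (zMono (Δ + (m : ℝ)) j))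
  set Q := pointFunctional (w 3) z zb (crossF Δσ (-1) (zMono (Δ + (m : ℝ)) j)) -
    pointFunctional (w 4) z zb (crossF Δσ 1 (zMono (Δ + (m : ℝ)) j))
  have hsgn : |(-1 : ℝ) ^ ℓ| = 1 := by simp
  have h1 : -(|A| * |P|) ≤ (-1 : ℝ) ^ ℓ * A * P := by
    have := neg_abs_le ((-1 : ℝ) ^ ℓ * A * P)
    rwa [abs_mul, abs_mul, hsgn, one_mul] at this
  have hpos : 0 ≤ (-1 : ℝ) ^ ℓ * A * P + B * Q := by linarith
  have hlam := legendreLam_pos ℓ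
  have key : oddTermForm z zb w Δσ Δε Δ ℓ m j =
      ((-1 : ℝ) ^ ℓ * A * P + B * Q) / legendreLam ℓ := by
    simp only [oddTermForm, A, B, P, Q]
    field_simp
  rw [key]
  exact div_nonneg hpos hlam.le

/-! ### Non-regular points by right limits -/

/-- The even-sector quadratic form of a point 5-vector is continuous along the limit clause:
if `G Δ' → g` pointwise on the square then `evenForm(G Δ'; a, b) → evenForm(g; a, b)`.
[folklore] -/
theorem tendsto_evenForm_ofPoints {n : ℕ} (z zb : Fin n → ℝ) (w : Fin 5 → Fin n → ℝ)
    (hz : ∀ k, z k ∈ Ioo (0 : ℝ) 1) (hzb : ∀ k, zb k ∈ Ioo (0 : ℝ) 1) (Δσ Δε a b : ℝ)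
    (G : ℝ → ℝ → ℝ → ℝ) (g : ℝ → ℝ → ℝ) (l : Filter ℝ)
    (hG : ∀ x y : ℝ, x ∈ Ioo (0 : ℝ) 1 → y ∈ Ioo (0 : ℝ) 1 →
      Tendsto (fun Δ' => G Δ' x y) l (𝓝 (g x y))) :
    Tendsto (fun Δ' => (CrossingFunctional.ofPoints z zb w).evenForm Δσ Δε (G Δ') a b) l
      (𝓝 ((CrossingFunctional.ofPoints z zb w).evenForm Δσ Δε g a b)) := by
  simp only [CrossingFunctional.evenForm, CrossingFunctional.ofPoints]
  refine Tendsto.add (Tendsto.add ?_ ?_) ?_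
  · exact Tendsto.const_mul _ (tendsto_pointFunctional_crossF (w 0) z zb hz hzb Δσ (-1) G g l hG)
  · exact Tendsto.const_mul _ (tendsto_pointFunctional_crossF (w 1) z zb hz hzb Δε (-1) G g l hG)
  · exact Tendsto.const_mul _ (Tendsto.add
      (tendsto_pointFunctional_crossF (w 3) z zb hz hzb _ (-1) G g l hG)
      (tendsto_pointFunctional_crossF (w 4) z zb hz hzb _ 1 G g l hG))

/-- **Even-sector positivity at a non-regular point from the right**: if `(Δ, ℓ)` is not regular and
`EvenPositive` holds at the regular points of a right neighbourhood, it holds at `(Δ, ℓ)` (limit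
clause of `IsConformalBlock3D`, `ge_of_tendsto`). [folklore] -/
theorem evenPositive_ofPoints_of_eventually_right {n : ℕ} (z zb : Fin n → ℝ)
    (w : Fin 5 → Fin n → ℝ) (hz : ∀ k, z k ∈ Ioo (0 : ℝ) 1) (hzb : ∀ k, zb k ∈ Ioo (0 : ℝ) 1)
    (Δσ Δε Δ : ℝ) (ℓ : ℕ) (hΔ : ¬ IsRegularPoint3D Δ ℓ)
    (h : ∀ᶠ Δ' in 𝓝[>] Δ, IsRegularPoint3D Δ' ℓ ∧
      (CrossingFunctional.ofPoints z zb w).EvenPositive Δσ Δε Δ' ℓ) :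
    (CrossingFunctional.ofPoints z zb w).EvenPositive Δσ Δε Δ ℓ := by
  intro g hg a b
  rcases hg with ⟨hreg, _⟩ | ⟨_, G, hGabove, hGlim⟩
  · exact absurd hreg hΔ
  have hlim := tendsto_evenForm_ofPoints z zb w hz hzb Δσ Δε a b G g (𝓝[>] Δ) hGlim
  refine ge_of_tendsto hlim ?_
  have hIoo : Ioo Δ (Δ + 1) ∈ 𝓝[>] Δ := Ioo_mem_nhdsGT (by linarith)
  filter_upwards [h, hIoo] with Δ' hΔ' hmem
  exact hΔ'.2 (G Δ') (Or.inl ⟨hΔ'.1, hGabove Δ' hmem⟩) a b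

/-- The odd-sector form of a point 5-vector is continuous along a pair of limit clauses. [folklore] -/
theorem tendsto_oddForm_ofPoints {n : ℕ} (z zb : Fin n → ℝ) (w : Fin 5 → Fin n → ℝ)
    (hz : ∀ k, z k ∈ Ioo (0 : ℝ) 1) (hzb : ∀ k, zb k ∈ Ioo (0 : ℝ) 1) (Δσ Δε : ℝ) (ℓ : ℕ)
    (G₁ G₂ : ℝ → ℝ → ℝ → ℝ) (g₁ g₂ : ℝ → ℝ → ℝ) (l : Filter ℝ)
    (hG₁ : ∀ x y : ℝ, x ∈ Ioo (0 : ℝ) 1 → y ∈ Ioo (0 : ℝ) 1 →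
      Tendsto (fun Δ' => G₁ Δ' x y) l (𝓝 (g₁ x y)))
    (hG₂ : ∀ x y : ℝ, x ∈ Ioo (0 : ℝ) 1 → y ∈ Ioo (0 : ℝ) 1 →
      Tendsto (fun Δ' => G₂ Δ' x y) l (𝓝 (g₂ x y))) :
    Tendsto (fun Δ' => (CrossingFunctional.ofPoints z zb w).oddForm Δσ Δε ℓ (G₁ Δ') (G₂ Δ')) l
      (𝓝 ((CrossingFunctional.ofPoints z zb w).oddForm Δσ Δε ℓ g₁ g₂)) := by
  simp only [CrossingFunctional.oddForm, CrossingFunctional.ofPoints]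
  refine Tendsto.sub (Tendsto.add ?_ ?_) ?_
  · exact Tendsto.const_mul _ (tendsto_pointFunctional_crossF (w 2) z zb hz hzb _ (-1) G₁ g₁ l hG₁)
  · exact tendsto_pointFunctional_crossF (w 3) z zb hz hzb Δσ (-1) G₂ g₂ l hG₂
  · exact tendsto_pointFunctional_crossF (w 4) z zb hz hzb Δσ 1 G₂ g₂ l hG₂

/-- **Odd-sector positivity at a non-regular point from the right.** [folklore] -/
theorem oddPositive_ofPoints_of_eventually_right {n : ℕ} (z zb : Fin n → ℝ)
    (w : Fin 5 → Fin n → ℝ) (hz : ∀ k, z k ∈ Ioo (0 : ℝ) 1) (hzb : ∀ k, zb k ∈ Ioo (0 : ℝ) 1)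
    (Δσ Δε Δ : ℝ) (ℓ : ℕ) (hΔ : ¬ IsRegularPoint3D Δ ℓ)
    (h : ∀ᶠ Δ' in 𝓝[>] Δ, IsRegularPoint3D Δ' ℓ ∧
      (CrossingFunctional.ofPoints z zb w).OddPositive Δσ Δε Δ' ℓ) :
    (CrossingFunctional.ofPoints z zb w).OddPositive Δσ Δε Δ ℓ := by
  intro g₁ g₂ hg₁ hg₂
  rcases hg₁ with ⟨hreg, _⟩ | ⟨_, G₁, hG₁above, hG₁lim⟩
  · exact absurd hreg hΔ
  rcases hg₂ with ⟨hreg, _⟩ | ⟨_, G₂, hG₂above, hG₂lim⟩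
  · exact absurd hreg hΔ
  have hlim := tendsto_oddForm_ofPoints z zb w hz hzb Δσ Δε ℓ G₁ G₂ g₁ g₂ (𝓝[>] Δ) hG₁lim hG₂lim
  refine ge_of_tendsto hlim ?_
  have hIoo : Ioo Δ (Δ + 1) ∈ 𝓝[>] Δ := Ioo_mem_nhdsGT (by linarith)
  filter_upwards [h, hIoo] with Δ' hΔ' hmem
  exact hΔ'.2 (G₁ Δ') (G₂ Δ') (Or.inl ⟨hΔ'.1, hG₁above Δ' hmem⟩) (Or.inl ⟨hΔ'.1, hG₂above Δ' hmem⟩)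

end Literature.MathematicalPhysics.QuantumFieldTheory.ConformalBootstrap3D
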